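import Summits.QuantumFields.GaugeBoot.PlaquetteInsertion
import HarnessLib

/-!
# The one-link Schwinger–Dyson identity for word holonomies: pair form and polarisation (cell `gauge-boot`, L1, file 4/5)

Honest framing (cell rule): certified bounds on lattice expectations at stated coupling, gauge group, dimension and
torus size; NOT a mass gap, NOT a continuum limit, NOT a string tension; not summit-bearing
(`FixedCouplingUltralocality`, `PerturbativeInvisibility`).

For a compact group `G` with lattice representation `r` (`LatticeRep`: faithful continuous unitary `ρ : G →* M_N(ℂ)`),
Wilson's measure `μ_β = wilsonMeasure r.ρ β` on the torus `(ℤ/L)^d`, an edge `e = (x, μ)` and a word `w` read from `x₀`: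
* `integral_shiftDeriv_eq_wilson_complex` — the tree's one-link Schwinger–Dyson identity
  (`…CurvatureAmnesia.WardDefect.SchwingerDyson.integral_shiftDeriv_eq_wilson`, proved in
  `Summits/QuantumFields/YangMills/Theorems/ScalingWindowSplitCurvatureAmnesiaWilsonSchwingerDyson.lean`) for complex
  observables;
* `sd_pair` — THE PAIR IDENTITY: for a skew-Hermitian `X` generating a one-parameter subgroup of `G` through `r.ρ` and
  ANY matrix `Y`, `∫ tr(Y·insDeriv_X hol_w) dμ_β = β ∫ tr(Y·ρ(hol_w))·(−½ plaqIns_X) dμ_β` (`f = tr(Yρ(hol_w))`,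
  `S' = actionDeriv = −½ plaqIns`);
* `SDPair` (the identity as a predicate in `X`), its `ℂ`-linearity in `X` (`insDeriv_add/_smul`, `plaqIns_add/_smul`)
  and POLARISATION: if it holds for all (traceless) skew-Hermitian `X` it holds for all (traceless) `X`
  (`sdPair_of_skew`, `sdPair_of_traceless`; `X = ½(X − Xᴴ) − i·(i/2)(X + Xᴴ)`), which is what lets
  `LoopEquation.lean` contract over matrix units instead of an explicit basis of `𝔰𝔲(N)`.
Everything is `[folklore]`.

References: M. Creutz, *Quarks, gluons and lattices* (1983) Ch. 11; S. Chatterjee, arXiv:1502.07719 §3; H. Shen,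
S. Smith, R. Zhu, arXiv:2202.00880 §3 (integration by parts on one link); cell file MM-DERIVATION.md §§3, 6.
-/

noncomputable section

open MeasureTheory Filter Topology NormedSpace
open scoped Matrix.Norms.Frobenius Matrix
open Literature.MathematicalPhysics.QuantumFieldTheory
open Summit.QuantumFields.YangMills.Cruxes.CurvatureAmnesia.WardDefect.SchwingerDyson

namespace Summit.QuantumFields.GaugeBoot

variable {d L N : ℕ} {G : Type} [Group G] {ρ : G →* Matrix (Fin N) (Fin N) ℂ} {e : Edge d L}
  {X : Matrix (Fin N) (Fin N) ℂ}

section Linearity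

/-- `stepIns` is additive in the direction `X`. [folklore] -/
theorem stepIns_add (X₁ X₂ : Matrix (Fin N) (Fin N) ℂ) (U : GaugeConfig d L G) (x : Site d L) (s : Step d) :
    stepIns ρ e (X₁ + X₂) U x s = stepIns ρ e X₁ U x s + stepIns ρ e X₂ U x s := by
  unfold stepIns
  split_ifs
  · rw [Matrix.add_mul]
  · rw [neg_add, Matrix.mul_add]
  · rw [add_zero]

/-- `stepIns` is homogeneous in the direction `X`. [folklore] -/
theorem stepIns_smul (c : ℂ) (X : Matrix (Fin N) (Fin N) ℂ) (U : GaugeConfig d L G) (x : Site d L) (s : Step d) :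
    stepIns ρ e (c • X) U x s = c • stepIns ρ e X U x s := by
  unfold stepIns
  split_ifs <;> simp

/-- `insDeriv` is additive in the direction `X`. [folklore] -/
theorem insDeriv_add (X₁ X₂ : Matrix (Fin N) (Fin N) ℂ) (U : GaugeConfig d L G) :
    ∀ (x : Site d L) (w : Word d),
      insDeriv ρ e (X₁ + X₂) U x w = insDeriv ρ e X₁ U x w + insDeriv ρ e X₂ U x w
  | x, [] => by simp
  | x, st :: w => by
    simp only [insDeriv_cons, stepIns_add, insDeriv_add X₁ X₂ U (st.apply x) w, Matrix.add_mul, Matrix.mul_add]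
    abel

/-- `insDeriv` is homogeneous in the direction `X`. [folklore] -/
theorem insDeriv_smul (c : ℂ) (X : Matrix (Fin N) (Fin N) ℂ) (U : GaugeConfig d L G) :
    ∀ (x : Site d L) (w : Word d), insDeriv ρ e (c • X) U x w = c • insDeriv ρ e X U x w
  | x, [] => by simp
  | x, st :: w => by
    simp only [insDeriv_cons, stepIns_smul, insDeriv_smul c X U (st.apply x) w, Matrix.smul_mul, Matrix.mul_smul,
      smul_add]

/-- `plaqIns` is additive in `X`. [folklore] -/
theorem plaqIns_add (X₁ X₂ : Matrix (Fin N) (Fin N) ℂ) (U : GaugeConfig d L G) (x : Site d L) (μ : Fin d) :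
    plaqIns ρ (X₁ + X₂) U x μ = plaqIns ρ X₁ U x μ + plaqIns ρ X₂ U x μ := by
  simp only [plaqIns, Matrix.add_mul, Matrix.trace_add, Finset.sum_add_distrib]

/-- `plaqIns` is homogeneous in `X`. [folklore] -/
theorem plaqIns_smul (c : ℂ) (X : Matrix (Fin N) (Fin N) ℂ) (U : GaugeConfig d L G) (x : Site d L) (μ : Fin d) :
    plaqIns ρ (c • X) U x μ = c * plaqIns ρ X U x μ := by
  simp only [plaqIns, Matrix.smul_mul, Matrix.trace_smul, smul_eq_mul, Finset.mul_sum]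

end Linearity

section SDPair

variable [TopologicalSpace G] [IsTopologicalGroup G] [CompactSpace G] [MeasurableSpace G] [BorelSpace G]
  (r : LatticeRep G)

/-- Continuous (complex) observables on the compact configuration space are integrable for Wilson's measure
(given the faithful matrix representation `r`, which makes `G` second countable). [folklore] -/
theorem integrable_of_continuous [NeZero L] (β : ℝ) {F : GaugeConfig d L G → ℂ} (hF : Continuous F) :
    Integrable F (wilsonMeasure (d := d) (L := L) r.ρ β) := by
  haveI : SecondCountableTopology G :=
    (r.continuous.isClosedEmbedding r.injective).isEmbedding.secondCountableTopology
  haveI := isProbabilityMeasure_wilsonMeasure (d := d) (L := L) r.ρ r.continuous β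
  obtain ⟨C, hC⟩ := isCompact_univ.exists_bound_of_continuousOn hF.continuousOn
  exact Integrable.of_bound hF.measurable.aestronglyMeasurable C (ae_of_all _ fun U => hC U (Set.mem_univ U))

/-- **Complex-valued one-link Schwinger–Dyson identity**: the tree's `integral_shiftDeriv_eq_wilson` applied to the
real and imaginary parts of a continuous complex observable. [folklore] -/
theorem integral_shiftDeriv_eq_wilson_complex [NeZero L] (β : ℝ) (e : Edge d L) {k : ℝ → G}
    (hk : ∀ s t, k (s + t) = k s * k t) (f f' : GaugeConfig d L G → ℂ) (hf : Continuous f)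
    (hf'c : Continuous f')
    (hf' : ∀ U, HasDerivAt (fun t => f (Function.update U e (k t * U e))) (f' U) 0)
    (S' : GaugeConfig d L G → ℝ) (hS'c : Continuous S')
    (hS' : ∀ U, HasDerivAt (fun t => wilsonAction (d := d) (L := L) r.ρ (Function.update U e (k t * U e)))
      (S' U) 0) :
    ∫ U, f' U ∂(wilsonMeasure (d := d) (L := L) r.ρ β) =
      (β : ℂ) * ∫ U, f U * (S' U : ℂ) ∂(wilsonMeasure (d := d) (L := L) r.ρ β) := by
  have hre := integral_shiftDeriv_eq_wilson r β e hk (fun U => (f U).re) (fun U => (f' U).re)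
    (Complex.continuous_re.comp hf) (Complex.continuous_re.comp hf'c)
    (fun U => by simpa [Function.comp_def] using (Complex.reCLM.hasFDerivAt.comp_hasDerivAt (0 : ℝ) (hf' U))) S' hS'c hS'
  have him := integral_shiftDeriv_eq_wilson r β e hk (fun U => (f U).im) (fun U => (f' U).im)
    (Complex.continuous_im.comp hf) (Complex.continuous_im.comp hf'c)
    (fun U => by simpa [Function.comp_def] using (Complex.imCLM.hasFDerivAt.comp_hasDerivAt (0 : ℝ) (hf' U))) S' hS'c hS'
  have hi1 : Integrable f' (wilsonMeasure (d := d) (L := L) r.ρ β) := integrable_of_continuous r β hf'c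
  have hi2 : Integrable (fun U => f U * (S' U : ℂ)) (wilsonMeasure (d := d) (L := L) r.ρ β) :=
    integrable_of_continuous r β (hf.mul (Complex.continuous_ofReal.comp hS'c))
  apply Complex.ext
  · have h1 := Complex.reCLM.integral_comp_comm hi1
    have h2 := Complex.reCLM.integral_comp_comm hi2
    simp only [Complex.reCLM_apply, Complex.mul_re, Complex.ofReal_re, Complex.ofReal_im, mul_zero,
      sub_zero] at h1 h2
    rw [← h1, hre, Complex.re_ofReal_mul, ← h2]
  · have h1 := Complex.imCLM.integral_comp_comm hi1
    have h2 := Complex.imCLM.integral_comp_comm hi2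
    simp only [Complex.imCLM_apply, Complex.mul_im, Complex.ofReal_re, Complex.ofReal_im, mul_zero,
      zero_add] at h1 h2
    rw [← h1, him, Complex.im_ofReal_mul, ← h2]

/-- The real-linear functional `M ↦ tr(Y M)` as a continuous linear map (for the chain rule). [folklore] -/
def traceMulLeftCLM (Y : Matrix (Fin N) (Fin N) ℂ) : Matrix (Fin N) (Fin N) ℂ →L[ℝ] ℂ :=
  LinearMap.toContinuousLinearMap
    (((Matrix.traceLinearMap (Fin N) ℂ ℂ).comp (LinearMap.mulLeft ℂ Y)).restrictScalars ℝ)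

/-- Unfolding lemma `traceMulLeftCLM_apply`. [folklore] -/
@[simp] theorem traceMulLeftCLM_apply (Y M : Matrix (Fin N) (Fin N) ℂ) : traceMulLeftCLM Y M = (Y * M).trace := rfl

/-- **The one-link Schwinger–Dyson identity for a word (pair form).** For an admissible direction `X` (skew-Hermitian,
generating a one-parameter subgroup `k` of `G` through `r.ρ(k t) = exp(tX)`), ANY matrix `Y`, any word `w` read
from `x₀`, and the edge `e = (x, μ)`:
`∫ tr(Y·insDeriv_X hol_w) dμ_β = β ∫ tr(Y·ρ(hol_w)) · (−½ plaqIns_X) dμ_β`.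
This is `integral_shiftDeriv_eq_wilson` with `f = tr(Y ρ(hol_w))`, `f' = tr(Y insDeriv)`, `S' = actionDeriv`,
followed by `actionDeriv_eq_plaqIns`. [folklore] -/
theorem sd_pair [NeZero L] (β : ℝ) (x : Site d L) (μ : Fin d) {k : ℝ → G} (hk : ∀ s t, k (s + t) = k s * k t)
    {X : Matrix (Fin r.N) (Fin r.N) ℂ} (hX : ∀ t, r.ρ (k t) = exp ((t : ℂ) • X)) (hXs : Xᴴ = -X)
    (Y : Matrix (Fin r.N) (Fin r.N) ℂ) (x₀ : Site d L) (w : Word d) :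
    ∫ U, (Y * insDeriv r.ρ (x, μ) X U x₀ w).trace ∂(wilsonMeasure (d := d) (L := L) r.ρ β) =
      (β : ℂ) * ∫ U, (Y * r.ρ (wordHolonomy U x₀ w)).trace * (-(1 / 2) * plaqIns r.ρ X U x μ)
        ∂(wilsonMeasure (d := d) (L := L) r.ρ β) := by
  have h := integral_shiftDeriv_eq_wilson_complex r β (x, μ) hk
    (fun U => (Y * r.ρ (wordHolonomy U x₀ w)).trace) (fun U => (Y * insDeriv r.ρ (x, μ) X U x₀ w).trace)
    ((continuous_const.mul (r.continuous.comp (continuous_wordHolonomy x₀ w))).matrix_trace)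
    ((continuous_const.mul (continuous_insDeriv (e := (x, μ)) (X := X) r.continuous x₀ w)).matrix_trace)
    (fun U => by
      have hd := (traceMulLeftCLM Y).hasFDerivAt.comp_hasDerivAt (0 : ℝ)
        (hasDerivAt_wordHolonomy (e := (x, μ)) hk hX U x₀ w)
      simpa [Function.comp_def] using hd.congr_deriv (traceMulLeftCLM_apply Y _))
    (actionDeriv r.ρ (x, μ) X) (continuous_actionDeriv (e := (x, μ)) (X := X) r.continuous)
    (fun U => hasDerivAt_wilsonAction (e := (x, μ)) hk hX U)
  rw [h]
  congr 1
  refine integral_congr_ae (ae_of_all _ fun U => ?_)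
  simp only [actionDeriv_eq_plaqIns hXs r.mem_unitary U x μ]

end SDPair

section Polarisation

variable [TopologicalSpace G] [IsTopologicalGroup G] (r : LatticeRep G)

/-- Continuity of `U ↦ tr(Y·insDeriv)`. [folklore] -/
theorem continuous_trace_mul_insDeriv (Y X : Matrix (Fin r.N) (Fin r.N) ℂ) (e : Edge d L) (x₀ : Site d L)
    (w : Word d) : Continuous fun U : GaugeConfig d L G => (Y * insDeriv r.ρ e X U x₀ w).trace :=
  (continuous_const.mul (continuous_insDeriv (e := e) (X := X) r.continuous x₀ w)).matrix_trace

/-- Continuity of `U ↦ plaqIns`. [folklore] -/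
theorem continuous_plaqIns (X : Matrix (Fin r.N) (Fin r.N) ℂ) (x : Site d L) (μ : Fin d) :
    Continuous fun U : GaugeConfig d L G => plaqIns r.ρ X U x μ := by
  unfold plaqIns
  refine continuous_finsetSum _ fun ν _ => continuous_finsetSum _ fun ε _ => ?_
  exact (continuous_const.mul ((r.continuous.comp (continuous_wordHolonomy x _)).sub
    (r.continuous.comp (continuous_wordHolonomy x _)))).matrix_trace

/-- Continuity of the right-hand integrand `tr(Y ρ(hol_w))·(−½ plaqIns)`. [folklore] -/
theorem continuous_rhsIntegrand (Y X : Matrix (Fin r.N) (Fin r.N) ℂ) (x : Site d L) (μ : Fin d) (x₀ : Site d L)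
    (w : Word d) : Continuous fun U : GaugeConfig d L G =>
      (Y * r.ρ (wordHolonomy U x₀ w)).trace * (-(1 / 2) * plaqIns r.ρ X U x μ) :=
  (continuous_const.mul (r.continuous.comp (continuous_wordHolonomy x₀ w))).matrix_trace.mul
    (continuous_const.mul (continuous_plaqIns r X x μ))

variable [CompactSpace G] [MeasurableSpace G] [BorelSpace G]

/-- THE PAIR IDENTITY for the direction `X` (word `w` from `x₀`, edge `(x, μ)`, coupling `β`): for every `Y`,
`∫ tr(Y·insDeriv_X hol_w) dμ_β = β ∫ tr(Y ρ(hol_w))·(−½ plaqIns_X) dμ_β`.  Proved for admissible skew-Hermitian `X`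
(`sd_pair`); `ℂ`-linear in `X`, whence polarisation.  (A predicate with parameters used to organise the
proof — not a named fact.) [folklore] -/
def SDPair [NeZero L] (β : ℝ) (x : Site d L) (μ : Fin d) (x₀ : Site d L) (w : Word d)
    (X : Matrix (Fin r.N) (Fin r.N) ℂ) : Prop :=
  ∀ Y : Matrix (Fin r.N) (Fin r.N) ℂ,
    ∫ U, (Y * insDeriv r.ρ (x, μ) X U x₀ w).trace ∂(wilsonMeasure (d := d) (L := L) r.ρ β) =
      (β : ℂ) * ∫ U, (Y * r.ρ (wordHolonomy U x₀ w)).trace * (-(1 / 2) * plaqIns r.ρ X U x μ)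
        ∂(wilsonMeasure (d := d) (L := L) r.ρ β)

/-- `sd_pair` restated: admissible skew-Hermitian directions satisfy the pair identity. [folklore] -/
theorem sdPair_of_oneParam [NeZero L] (β : ℝ) (x : Site d L) (μ : Fin d) (x₀ : Site d L) (w : Word d)
    {X : Matrix (Fin r.N) (Fin r.N) ℂ} (hXs : Xᴴ = -X) {k : ℝ → G} (hk : ∀ s t, k (s + t) = k s * k t)
    (hX : ∀ t, r.ρ (k t) = exp ((t : ℂ) • X)) : SDPair r β x μ x₀ w X :=
  fun Y => sd_pair r β x μ hk hX hXs Y x₀ w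

/-- The skew-Hermitian part `½(X − Xᴴ)` is skew-Hermitian. [folklore] -/
theorem conjTranspose_skewPart (X : Matrix (Fin N) (Fin N) ℂ) :
    ((1 / 2 : ℂ) • (X - Xᴴ))ᴴ = -((1 / 2 : ℂ) • (X - Xᴴ)) := by
  rw [Matrix.conjTranspose_smul, Matrix.conjTranspose_sub, Matrix.conjTranspose_conjTranspose, ← smul_neg, neg_sub]
  congr 1
  simp

/-- `(i/2)(X + Xᴴ)` is skew-Hermitian. [folklore] -/
theorem conjTranspose_iHermPart (X : Matrix (Fin N) (Fin N) ℂ) :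
    ((Complex.I / 2) • (X + Xᴴ))ᴴ = -((Complex.I / 2) • (X + Xᴴ)) := by
  rw [Matrix.conjTranspose_smul, Matrix.conjTranspose_add, Matrix.conjTranspose_conjTranspose, ← neg_smul, add_comm]
  congr 1
  simp [div_eq_mul_inv]

/-- The decomposition `X = ½(X − Xᴴ) + (−i)·(i/2)(X + Xᴴ)`. [folklore] -/
theorem eq_skewPart_add (X : Matrix (Fin N) (Fin N) ℂ) :
    X = (1 / 2 : ℂ) • (X - Xᴴ) + (-Complex.I) • ((Complex.I / 2) • (X + Xᴴ)) := by
  rw [smul_smul, show -Complex.I * (Complex.I / 2) = 1 / 2 by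
    rw [mul_div_assoc', neg_mul, Complex.I_mul_I, neg_neg], ← smul_add, sub_add_add_cancel, ← two_smul ℂ X,
    smul_smul]
  norm_num

/-- The two parts of a traceless matrix are traceless. [folklore] -/
theorem trace_parts_eq_zero {X : Matrix (Fin N) (Fin N) ℂ} (hX : X.trace = 0) (c : ℂ) :
    (c • (X - Xᴴ)).trace = 0 ∧ (c • (X + Xᴴ)).trace = 0 := by
  rw [Matrix.trace_smul, Matrix.trace_smul, smul_eq_mul, smul_eq_mul, Matrix.trace_sub, Matrix.trace_add,
    Matrix.trace_conjTranspose, hX, star_zero, sub_zero, add_zero, mul_zero]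
  exact ⟨rfl, rfl⟩

/-- **Polarisation step**: the pair identity for the two skew-Hermitian parts of `X` implies it for `X` (both sides
are `ℂ`-linear in `X`). [folklore] -/
theorem sdPair_of_parts [NeZero L] (β : ℝ) (x : Site d L) (μ : Fin d) (x₀ : Site d L) (w : Word d)
    (X : Matrix (Fin r.N) (Fin r.N) ℂ) (hPA : SDPair r β x μ x₀ w ((1 / 2 : ℂ) • (X - Xᴴ)))
    (hPB : SDPair r β x μ x₀ w ((Complex.I / 2) • (X + Xᴴ))) : SDPair r β x μ x₀ w X := by
  set A : Matrix (Fin r.N) (Fin r.N) ℂ := (1 / 2 : ℂ) • (X - Xᴴ) with hA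
  set B : Matrix (Fin r.N) (Fin r.N) ℂ := (Complex.I / 2) • (X + Xᴴ) with hB
  have hXAB : X = A + (-Complex.I) • B := eq_skewPart_add X
  clear_value A B
  intro Y
  have hiA := integrable_of_continuous r β (continuous_trace_mul_insDeriv r Y A (x, μ) x₀ w)
  have hiB := integrable_of_continuous r β (continuous_trace_mul_insDeriv r Y B (x, μ) x₀ w)
  have hjA := integrable_of_continuous r β (continuous_rhsIntegrand r Y A x μ x₀ w)
  have hjB := integrable_of_continuous r β (continuous_rhsIntegrand r Y B x μ x₀ w)
  have hl : ∀ U : GaugeConfig d L G, (Y * insDeriv r.ρ (x, μ) X U x₀ w).trace =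
      (Y * insDeriv r.ρ (x, μ) A U x₀ w).trace + (-Complex.I) * (Y * insDeriv r.ρ (x, μ) B U x₀ w).trace := by
    intro U
    rw [hXAB, insDeriv_add, insDeriv_smul, Matrix.mul_add, Matrix.mul_smul, Matrix.trace_add, Matrix.trace_smul,
      smul_eq_mul]
  have hr : ∀ U : GaugeConfig d L G,
      (Y * r.ρ (wordHolonomy U x₀ w)).trace * (-(1 / 2) * plaqIns r.ρ X U x μ) =
        (Y * r.ρ (wordHolonomy U x₀ w)).trace * (-(1 / 2) * plaqIns r.ρ A U x μ) +
          (-Complex.I) * ((Y * r.ρ (wordHolonomy U x₀ w)).trace * (-(1 / 2) * plaqIns r.ρ B U x μ)) := by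
    intro U
    rw [hXAB, plaqIns_add, plaqIns_smul]
    ring
  simp_rw [hl, hr]
  rw [integral_add hiA (hiB.const_mul _), integral_const_mul, integral_add hjA (hjB.const_mul _),
    integral_const_mul, hPA Y, hPB Y]
  ring

/-- **Polarisation (`𝔰𝔲`-type).** If every traceless skew-Hermitian direction satisfies the pair identity, so does
every traceless direction (`𝔰𝔲(N) ⊗ ℂ = 𝔰𝔩_N(ℂ)`). [folklore] -/
theorem sdPair_of_traceless [NeZero L] (β : ℝ) (x : Site d L) (μ : Fin d) (x₀ : Site d L) (w : Word d)
    (hadm : ∀ X : Matrix (Fin r.N) (Fin r.N) ℂ, Xᴴ = -X → X.trace = 0 → SDPair r β x μ x₀ w X)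
    (X : Matrix (Fin r.N) (Fin r.N) ℂ) (hX : X.trace = 0) : SDPair r β x μ x₀ w X :=
  sdPair_of_parts r β x μ x₀ w X (hadm _ (conjTranspose_skewPart X) (trace_parts_eq_zero hX _).1)
    (hadm _ (conjTranspose_iHermPart X) (trace_parts_eq_zero hX _).2)

/-- **Polarisation (`𝔲`-type).** If every skew-Hermitian direction satisfies the pair identity, so does every
direction (`𝔲(N) ⊗ ℂ = 𝔤𝔩_N(ℂ)`). [folklore] -/
theorem sdPair_of_skew [NeZero L] (β : ℝ) (x : Site d L) (μ : Fin d) (x₀ : Site d L) (w : Word d)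
    (hadm : ∀ X : Matrix (Fin r.N) (Fin r.N) ℂ, Xᴴ = -X → SDPair r β x μ x₀ w X)
    (X : Matrix (Fin r.N) (Fin r.N) ℂ) : SDPair r β x μ x₀ w X :=
  sdPair_of_parts r β x μ x₀ w X (hadm _ (conjTranspose_skewPart X)) (hadm _ (conjTranspose_iHermPart X))

end Polarisation

end Summit.QuantumFields.GaugeBoot

end
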